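import Mathlib
import Literature.AlgebraicGeometry.Resolution.FormalCoordinateChange

/-!
# The vertex chart of a cobordant blow-up and `s`-saturation of formal germs

For weights `w : Fin n → ℕ`, the full cobordant blow-up of `𝔸ⁿ` at the weighted centre
`V(xᵢ : wᵢ > 0)` is `B = Spec k[s, y₁, …, yₙ]`, `xᵢ = s^{wᵢ} yᵢ` (Włodarczyk arXiv:2203.03090,
Def. 2.3.5 / §4; `s = t⁻¹`); its chart at the VERTEX `y = 0` of the exceptional divisor
`{s = 0}` is the monomial substitution `vchart w : xᵢ ↦ s^{wᵢ} yᵢ` on formal power series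
(`s = X 0`, `yᵢ = X i.succ`).  The vertex is exactly what is removed to form `B₊ = B ∖ V(yᵢ :
wᵢ > 0)`.  This file records why: 

* `coeff_subst_vchart` — `coeff (e₀, e') (G(s^w y)) = if e₀ = w·e' then coeff e' G else 0`;
* `exists_eq_X_pow_mul_not_dvd` — every nonzero series is `sᵃ · g` with `s ∤ g` (the
  `s`-saturation defining the strict transform of a hypersurface);
* `vertexSuccessor_singular` — for `G ≠ 0` in `𝔪²`, the `s`-saturation `g` of `G(s^w y)` is in
  `𝔪²` again: the vertex successor of a singular germ is singular, for every weight vector;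
* `vertex_game_lost` — consequently NO rank function (ordinal-valued, depending arbitrarily on
  the number of variables and on the germ) drops at every singular `s`-saturated transform once
  the vertex is admitted as a challenge point, whatever coordinate change `θ` (zero constants,
  invertible linear part) and weights the player picks: the local weighted resolution game on
  the FULL cobordant blow-up `B` is lost; any winning strategy must live on `B₊`.

Folklore.
-/

open MvPowerSeries

namespace Literature.AlgebraicGeometry.Resolution.CobordantVertexChart

open Literature.AlgebraicGeometry.Resolution.FormalCoordChange

variable {k : Type*} [Field k] {n : ℕ}

variable {k : Type*} [Field k] {n : ℕ}


/-- The vertex chart `x_i ↦ X₀^{w i} · X_{i+1}` of the cobordant blow-up (`c = 0`). [folklore] -/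
noncomputable def vchart (w : Fin n → ℕ) : Fin n → MvPowerSeries (Fin (n + 1)) k :=
  fun i => MvPowerSeries.X 0 ^ (w i) * MvPowerSeries.X i.succ

/-- At the vertex `c = 0` the crux's chart family is literally `vchart w`. [folklore] -/
theorem chart_zero_eq_vchart (w : Fin n → ℕ) :
    (fun i : Fin n => if 0 < w i then
        MvPowerSeries.X (0 : Fin (n + 1)) ^ (w i) * (MvPowerSeries.C ((0 : Fin n → k) i) +
          MvPowerSeries.X i.succ)
      else (MvPowerSeries.X i.succ : MvPowerSeries (Fin (n + 1)) k)) = vchart w := by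
  funext i
  by_cases h : 0 < w i
  · simp [h, vchart]
  · have h0 : w i = 0 := by omega
    simp [vchart, h0]

/-- The vertex chart is substitutable. [folklore] -/
theorem hasSubst_vchart (w : Fin n → ℕ) : MvPowerSeries.HasSubst (vchart (k := k) w) :=
  MvPowerSeries.hasSubst_of_constantCoeff_zero fun i => by
    simp [vchart, MvPowerSeries.constantCoeff_X]

/-- Exponent of the image of `x^d` under the vertex chart: `(w·d, d)`. [folklore] -/
noncomputable def vexp (w : Fin n → ℕ) (d : Fin n →₀ ℕ) : Fin (n + 1) →₀ ℕ :=
  Finsupp.cons (Finsupp.weight w d) d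

/-- The `s`-exponent of the image of `x^d` is the `w`-weight of `d`. [folklore] -/
theorem vexp_zero_apply (w : Fin n → ℕ) (d : Fin n →₀ ℕ) : vexp w d 0 = Finsupp.weight w d :=
  Finsupp.cons_zero _ _

/-- The `y`-exponents of the image of `x^d` are `d`. [folklore] -/
theorem tail_vexp (w : Fin n → ℕ) (d : Fin n →₀ ℕ) : Finsupp.tail (vexp w d) = d :=
  Finsupp.tail_cons _ _

/-- `vexp` on a single exponent. [folklore] -/
theorem vexp_single (w : Fin n → ℕ) (i : Fin n) (m : ℕ) :
    vexp w (Finsupp.single i m) = Finsupp.single 0 (w i * m) + Finsupp.single i.succ m := by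
  ext j
  refine Fin.cases ?_ (fun j => ?_) j
  · simp [vexp, Finsupp.weight_single, mul_comm]
  · simp [vexp, Finsupp.cons_succ, Finsupp.single_apply, Fin.succ_ne_zero]

/-- `vexp` is additive. [folklore] -/
theorem vexp_add (w : Fin n → ℕ) (d₁ d₂ : Fin n →₀ ℕ) :
    vexp w (d₁ + d₂) = vexp w d₁ + vexp w d₂ := by
  ext j
  refine Fin.cases ?_ (fun j => ?_) j
  · simp [vexp, Finsupp.cons_zero]
  · simp [vexp, Finsupp.cons_succ]

/-- The vertex chart maps the monomial `x^d` to the monomial `s^{w·d} y^d`. [folklore] -/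
theorem prod_vchart_pow (w : Fin n → ℕ) (d : Fin n →₀ ℕ) :
    (d.prod fun s m => vchart (k := k) w s ^ m) = MvPowerSeries.monomial (vexp w d) 1 := by
  classical
  induction d using Finsupp.induction with
  | zero => simp [vexp, MvPowerSeries.monomial_zero_one]
  | single_add i m d hi hm ih =>
    rw [Finsupp.prod_add_index' (h := fun s m => vchart (k := k) w s ^ m) (fun _ => pow_zero _)
        (fun _ _ _ => pow_add _ _ _),
      Finsupp.prod_single_index (h := fun s m => vchart (k := k) w s ^ m) (pow_zero _), ih,
      vexp_add, ← one_mul (1 : k), ← MvPowerSeries.monomial_mul_monomial, one_mul]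
    congr 1
    rw [vchart, mul_pow, ← pow_mul, MvPowerSeries.X_pow_eq, MvPowerSeries.X_pow_eq,
      MvPowerSeries.monomial_mul_monomial, one_mul, vexp_single]

/-- COEFFICIENT FORMULA for the vertex chart: the coefficient of `s^{e₀} y^{e'}` in
`G(s^{w}y)` is `G_{e'}` if `e₀ = w·e'` and `0` otherwise. [folklore] -/
theorem coeff_subst_vchart (w : Fin n → ℕ) (G : MvPowerSeries (Fin n) k) (e : Fin (n + 1) →₀ ℕ) :
    MvPowerSeries.coeff e (MvPowerSeries.subst (vchart w) G) =
      if e 0 = Finsupp.weight w (Finsupp.tail e) then MvPowerSeries.coeff (Finsupp.tail e) G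
      else 0 := by
  classical
  rw [MvPowerSeries.coeff_subst (hasSubst_vchart w)]
  simp_rw [prod_vchart_pow, MvPowerSeries.coeff_monomial]
  rw [finsum_eq_single _ (Finsupp.tail e)]
  · have : (e = vexp w (Finsupp.tail e)) ↔ e 0 = Finsupp.weight w (Finsupp.tail e) := by
      constructor
      · intro h
        conv_lhs => rw [h]
        exact vexp_zero_apply _ _
      · intro h
        rw [← Finsupp.cons_tail e, h]
        simp [vexp]
    by_cases h : e 0 = Finsupp.weight w (Finsupp.tail e)
    · rw [if_pos (this.mpr h), if_pos h, smul_eq_mul, mul_one]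
    · rw [if_neg (fun hh => h (this.mp hh)), if_neg h, smul_zero]
  · intro d hd
    rw [if_neg, smul_zero]
    intro hh
    apply hd
    rw [hh, tail_vexp]

/-- The vertex chart kills no nonzero series. [folklore] -/
theorem subst_vchart_ne_zero (w : Fin n → ℕ) {G : MvPowerSeries (Fin n) k} (hG : G ≠ 0) :
    MvPowerSeries.subst (vchart (k := k) w) G ≠ 0 := by
  obtain ⟨d, hd⟩ : ∃ d, MvPowerSeries.coeff d G ≠ 0 := by
    by_contra hcon
    push Not at hcon
    exact hG (MvPowerSeries.ext fun d => by simpa using hcon d)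
  intro h0
  have := coeff_subst_vchart w G (vexp w d)
  rw [h0, map_zero, tail_vexp, vexp_zero_apply, if_pos rfl] at this
  exact hd this.symm

/-- `X₀`-ADIC FACTORISATION (`s`-saturation): a nonzero series is `X₀ᵃ · g` with `X₀ ∤ g`. [folklore] -/
theorem exists_eq_X_pow_mul_not_dvd {F : MvPowerSeries (Fin (n + 1)) k} (hF : F ≠ 0) :
    ∃ (a : ℕ) (g : MvPowerSeries (Fin (n + 1)) k),
      F = MvPowerSeries.X 0 ^ a * g ∧ ¬ MvPowerSeries.X 0 ∣ g := by
  classical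
  have hex : ∃ a, ∃ m : Fin (n + 1) →₀ ℕ, m 0 = a ∧ MvPowerSeries.coeff m F ≠ 0 := by
    by_contra hcon
    push Not at hcon
    exact hF (MvPowerSeries.ext fun m => by simpa using hcon (m 0) m rfl)
  obtain ⟨m, hm0, hm⟩ := Nat.find_spec hex
  have hmin : ∀ m' : Fin (n + 1) →₀ ℕ, m' 0 < Nat.find hex → MvPowerSeries.coeff m' F = 0 := by
    intro m' hm'
    have := Nat.find_min hex hm'
    push Not at this
    exact this m' rfl
  set a := Nat.find hex with ha_def
  clear_value a
  obtain ⟨g, hg⟩ := (MvPowerSeries.X_pow_dvd_iff).mpr hmin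
  refine ⟨a, g, hg, ?_⟩
  rintro ⟨g', rfl⟩
  have hdvd : MvPowerSeries.X (0 : Fin (n + 1)) ^ (a + 1) ∣ F :=
    ⟨g', by rw [hg]; ring⟩
  exact hm ((MvPowerSeries.X_pow_dvd_iff).mp hdvd m (by omega))

/-- Coefficients of the `s`-saturation. [folklore] -/
theorem coeff_of_eq_X_pow_mul {F g : MvPowerSeries (Fin (n + 1)) k} {a : ℕ}
    (h : F = MvPowerSeries.X 0 ^ a * g) (m : Fin (n + 1) →₀ ℕ) :
    MvPowerSeries.coeff m g = MvPowerSeries.coeff (m + Finsupp.single 0 a) F := by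
  rw [h, MvPowerSeries.X_pow_eq, MvPowerSeries.coeff_monomial_mul]
  simp

/-- THE VERTEX SUCCESSOR IS ALWAYS SINGULAR: for every nonzero `G ∈ 𝔪²` and every weight
vector `w`, the `s`-saturation `g` of `G(s^{w} y)` exists, and `g ∈ 𝔪²` again. [folklore] -/
theorem vertexSuccessor_singular (w : Fin n → ℕ) {G : MvPowerSeries (Fin n) k} (hG0 : G ≠ 0)
    (hG : MvPowerSeries.constantCoeff G = 0 ∧ ∀ i, MvPowerSeries.coeff (Finsupp.single i 1) G = 0) :
    ∃ (a : ℕ) (g : MvPowerSeries (Fin (n + 1)) k),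
      MvPowerSeries.subst (vchart (k := k) w) G = MvPowerSeries.X 0 ^ a * g ∧
      ¬ MvPowerSeries.X 0 ∣ g ∧
      MvPowerSeries.constantCoeff g = 0 ∧ ∀ j, MvPowerSeries.coeff (Finsupp.single j 1) g = 0 := by
  classical
  obtain ⟨a, g, hfac, hndvd⟩ := exists_eq_X_pow_mul_not_dvd (subst_vchart_ne_zero w hG0)
  refine ⟨a, g, hfac, hndvd, ?_, fun j => ?_⟩
  · rw [← MvPowerSeries.coeff_zero_eq_constantCoeff_apply, coeff_of_eq_X_pow_mul hfac, zero_add,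
      coeff_subst_vchart]
    have ht : Finsupp.tail (Finsupp.single (0 : Fin (n + 1)) a) = 0 := by
      ext i; simp [Finsupp.tail_apply, (Fin.succ_ne_zero i)]
    rw [ht]
    split_ifs
    · simpa using hG.1
    · rfl
  · rw [coeff_of_eq_X_pow_mul hfac, coeff_subst_vchart]
    refine Fin.cases ?_ (fun i => ?_) j
    · have ht : Finsupp.tail (Finsupp.single (0 : Fin (n + 1)) 1 + Finsupp.single 0 a) = 0 := by
        ext i; simp [Finsupp.tail_apply, (Fin.succ_ne_zero i)]
      rw [ht, if_neg]
      simp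
    · have ht : Finsupp.tail (Finsupp.single i.succ 1 + Finsupp.single (0 : Fin (n + 1)) a) =
          Finsupp.single i 1 := by
        ext i'
        simp [Finsupp.tail_apply, Finsupp.single_apply, Fin.succ_ne_zero, Fin.succ_inj]
      rw [ht]
      split_ifs
      · exact hG.2 i
      · rfl



/-- THE VERTEX GAME IS LOST over every field `k`: there is no rank function `ι` (ordinal-valued,
depending arbitrarily on `n` and on the germ) such that every singular germ `f ∈ k[[x₁..xₙ]]`
(`f ≠ 0`, `f ∈ 𝔪²`) admits a formal coordinate change `θ` (zero constant terms, invertible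
linear part) and weights `w` (some `wᵢ > 0`) after which EVERY singular `s`-saturated transform
`g` at EVERY point `c` of the exceptional divisor of the full cobordant blow-up `B = 𝔸ⁿ⁺¹` —
vertex `c = 0` included — has `ι g < ι f`.  (This is the crux `LocalWeightedDrop` of route
ResolutionOfSingularities/WeightedInvariant with its off-vertex guard deleted.)  Proof: a
singular germ of minimal rank has a singular vertex successor (`vertexSuccessor_singular` after
`subst_ne_zero_of_isUnit_det`). [folklore] -/
theorem vertex_game_lost (k : Type) [Field k] :
    ¬ ∃ ι : (n : ℕ) → MvPowerSeries (Fin n) k → Ordinal.{0}, ∀ (n : ℕ) (f : MvPowerSeries (Fin n) k), (f ≠ 0 ∧ MvPowerSeries.constantCoeff f = 0 ∧ ∀ i, MvPowerSeries.coeff (Finsupp.single i 1) f = 0) → ∃ (θ : Fin n → MvPowerSeries (Fin n) k) (w : Fin n → ℕ), (∀ i, MvPowerSeries.constantCoeff (θ i) = 0) ∧ IsUnit (Matrix.det (Matrix.of fun i j => MvPowerSeries.coeff (Finsupp.single j 1) (θ i))) ∧ (∃ i, 0 < w i) ∧ ∀ (c : Fin n → k), ∀ (a : ℕ) (g : MvPowerSeries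 (Fin (n + 1)) k), MvPowerSeries.subst (fun i : Fin n => if 0 < w i then MvPowerSeries.X (0 : Fin (n + 1)) ^ (w i) * (MvPowerSeries.C (c i) + MvPowerSeries.X i.succ) else MvPowerSeries.X i.succ) (MvPowerSeries.subst θ f) = MvPowerSeries.X (0 : Fin (n + 1)) ^ a * g → ¬ (MvPowerSeries.X (0 : Fin (n + 1)) ∣ g) → (MvPowerSeries.constantCoeff g = 0 ∧ ∀ j, MvPowerSeries.coeff (Finsupp.single j 1) g = 0) → ι (n + 1) g < ι n f := by
  classical
  rintro ⟨ι, H⟩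
  let P : (Σ n, MvPowerSeries (Fin n) k) → Prop := fun x =>
    x.2 ≠ 0 ∧ MvPowerSeries.constantCoeff x.2 = 0 ∧
      ∀ i, MvPowerSeries.coeff (Finsupp.single i 1) x.2 = 0
  have hne : ∃ x, P x := by
    refine ⟨⟨1, MvPowerSeries.X 0 ^ 2⟩, pow_ne_zero _ (X_ne_zero' _), by simp, fun i => ?_⟩
    have hi : i = 0 := Subsingleton.elim i 0
    subst hi
    simp [MvPowerSeries.X_pow_eq, MvPowerSeries.coeff_monomial]
  obtain ⟨x, hx, hmin⟩ := WellFounded.has_min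
    (InvImage.wf (fun x : Σ n, MvPowerSeries (Fin n) k => ι x.1 x.2) Ordinal.lt_wf) {x | P x} hne
  obtain ⟨n, f⟩ := x
  obtain ⟨hf0, hfc, hfl⟩ := hx
  obtain ⟨θ, w, hθ0, hdet, -, Hc⟩ := H n f ⟨hf0, hfc, hfl⟩
  have hG0 : MvPowerSeries.subst θ f ≠ 0 := subst_ne_zero_of_isUnit_det hθ0 hdet hf0
  have hG2 := (two_le_order_iff _).mp
    (two_le_order_subst θ hθ0 f ((two_le_order_iff f).mpr ⟨hfc, hfl⟩))
  obtain ⟨a, g, hfac, hndvd, hg0, hg1⟩ := vertexSuccessor_singular w hG0 hG2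
  have hlt := Hc 0 a g (by rw [chart_zero_eq_vchart w]; exact hfac) hndvd ⟨hg0, hg1⟩
  exact hmin ⟨n + 1, g⟩ ⟨(fun h => hndvd (h ▸ dvd_zero _) : g ≠ 0), hg0, hg1⟩ hlt

end Literature.AlgebraicGeometry.Resolution.CobordantVertexChart
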